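import Summits.ResolutionOfSingularities.ResolutionOfSingularities.Theorems.PurelyInseparableDim4ResConeLevelTwoSeed
import Summits.ResolutionOfSingularities.ResolutionOfSingularities.Theorems.PurelyInseparableDim4IsolatedLevelTwoWitness
import HarnessLib
import HarnessLib.Audit.Tags

/-!
# Purely inseparable four-folds — LEVEL-2 LEGALITY, part 1: the TRIPLE-merged seed and the triple-product
# isolation witness (K2(p) lane, slice B, memo v1.4 §9 (K23 (i), (iii)); cell `res-dim4-pi`)

[OURS · counted 0 · cell `res-dim4-pi` · K2(p) lane holder res-dim4-p-12 g3's brick (K23) by signature (bus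
2026-08-29 00:34Z; K7 route A∞(T) = K22 + K23 + FT), seat res-dim4-p-3 g3.]  Pure algebra; nothing here proves
K2(p), `NoIsolatedTrap p p` or resolution of singularities in dimension ≥ 4 / characteristic `p`; K16–K23 are the
bookkeeping of the light regime only.  AI kernel work, weaker than expert review.

With THREE stretch-born boundary letters present the merged ledger reads `u·G = S·(x_a x_b x_c) + T·h^d` (K22 (i)).
* §1 (namespace `ResCone`) **`levelTwo_seed_triple_order`** / **`levelTwo_seed_triple`** — the triple analogue of
  K16's `levelTwo_seed`: if `ord G ≥ d ≥ 3`, `in_d G = a₀·L^d`, `lin h = κ·L`, `h ∈ 𝔪₀` and a FOURTH letter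
  `e ≠ c` carries the form (`ℓ_e ≠ 0`), then `ord S ≥ d − 2`, so `S(0) = 0`, and `T(0)·κ^d = u(0)·a₀` (degree-`d`
  parts: `x_a x_b x_c·in_{d−3}S = (u(0)a₀ − T(0)κ^d)·L^d`, and `x_e^d` occurs only on the right).
* §2 (namespace `IsolatedBand`) **`not_isIsolated_of_cofactor_mem_span_triple'`** — K18 with the triple product:
  `S ∈ (x_a, x_b, h)`, `d ≥ 3`, `u(0) ≠ 0` put `u·x^r·G` in `(x_a, x_b, h)^{r_a + r_b + 3}`, so `x^r·G` is not an
  isolated `q`-fold point for `q ≤ r_a + r_b + 3` (K1); contrapositive `cofactor_not_mem_span_triple_of_isIsolated'`.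
Part 2 of K23 ((ii) legality `σ(w) = 0`, (iv) the minor kill at the child) reads res-dim4-p-9 g3's K22 outputs and
follows in a separate file.
bears_on: LADDER-RESOLUTION:D157-DOOR2 (res-dim4-pi · K2(p) · slice B · K23).  Supports
stmt-ResolutionOfSingularities-16155 (helper).
-/

set_option linter.dupNamespace false -- mandated namespace of this single-conjunct summit

noncomputable section

namespace Summit.ResolutionOfSingularities.ResolutionOfSingularities.Theorems.PIDim4

open MvPolynomial Finset
open Literature.AlgebraicGeometry.Resolution
open Literature.AlgebraicGeometry.Resolution.Hauser2010

variable {K : Type} [Field K]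

namespace ResCone

/-! ## 1. The triple-merged level-2 seed -/

/-- **THE TRIPLE-MERGED LEVEL-2 SEED, order form**: from `u·G = S·(x_a x_b x_c) + T·h^d` with `h ∈ 𝔪₀`,
`ord G ≥ d ≥ 3`, power cone `in_d G = a₀·L^d`, `lin h = κ·L` and a letter `e ≠ c` with `ℓ_e ≠ 0`:
`ord S ≥ d − 2` and `T(0)·κ^d = u(0)·a₀`. [OURS] [folklore] -/
theorem levelTwo_seed_triple_order {a b c : Fin 4} {G h u S T : MvPolynomial (Fin 4) K} {d : ℕ} (hd : 3 ≤ d)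
    (hG : u * G = S * (X a * X b * X c) + T * h ^ d) (hh : h ∈ originIdeal K)
    (hordG : ∀ m ∈ G.support, d ≤ m.degree) {a₀ κ : K} {ℓ : Fin 4 → K}
    (hcone : homogeneousComponent d G = C a₀ * (∑ i, C (ℓ i) * X i) ^ d)
    (hlin : homogeneousComponent 1 h = C κ * (∑ i, C (ℓ i) * X i)) {e : Fin 4} (hec : e ≠ c)
    (he : ℓ e ≠ 0) :
    (∀ m ∈ S.support, d - 2 ≤ m.degree) ∧ MvPolynomial.eval 0 T * κ ^ d = MvPolynomial.eval 0 u * a₀ := by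
  classical
  have hh0 : constantCoeff h = 0 := (NarrowApolarity.mem_originIdeal_iff h).mp hh
  -- orders
  have hoG : (d : ℕ∞) ≤ ordZero G := natCast_le_ordZero_of_forall_le_degree hordG
  have hohd : (d : ℕ∞) ≤ ordZero (h ^ d) := le_ordZero_pow_of_constantCoeff_eq_zero hh0 d
  have hoh : ((1 : ℕ) : ℕ∞) ≤ ordZero h := by rw [Nat.cast_one, one_le_ordZero_iff]; exact hh0
  have h0u : ((0 : ℕ) : ℕ∞) ≤ ordZero u := by simp
  have h0T : ((0 : ℕ) : ℕ∞) ≤ ordZero T := by simp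
  have hoSX : (d : ℕ∞) ≤ ordZero (S * (X a * X b * X c)) := by
    rw [show S * (X a * X b * X c) = u * G - T * h ^ d from eq_sub_of_add_eq hG.symm]
    exact le_ordZero_sub (hoG.trans (le_ordZero_mul_left u G)) (hohd.trans (le_ordZero_mul_left T (h ^ d)))
  have hmono : (X a * X b * X c : MvPolynomial (Fin 4) K) =
      monomial (Finsupp.single a 1 + Finsupp.single b 1 + Finsupp.single c 1) 1 := by
    rw [X, X, X, monomial_mul, monomial_mul, one_mul, one_mul]
  -- `ord S ≥ d − 3`, through the coefficients
  have hoS : (((d - 3 : ℕ)) : ℕ∞) ≤ ordZero S := by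
    rw [natCast_le_ordZero_iff_forall_coeff]
    intro m hm
    have h1 : coeff (m + (Finsupp.single a 1 + Finsupp.single b 1 + Finsupp.single c 1)) (S * (X a * X b * X c)) =
        0 := by
      refine coeff_eq_zero_of_degree_lt_ordZero (lt_of_lt_of_le ?_ hoSX)
      rw [map_add, map_add, map_add, Finsupp.degree_single, Finsupp.degree_single, Finsupp.degree_single]
      exact_mod_cast (show m.degree + (1 + 1 + 1) < d by omega)
    rwa [hmono, coeff_mul_monomial', if_pos le_add_self, add_tsub_cancel_right, mul_one] at h1
  have h3X : ((3 : ℕ) : ℕ∞) ≤ ordZero (X a * X b * X c : MvPolynomial (Fin 4) K) := by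
    rw [ordZero_mul, ordZero_mul, ordZero_X, ordZero_X, ordZero_X]; norm_num
  -- degree-`d` components of the ledger identity
  have hXabc : homogeneousComponent 3 (X a * X b * X c : MvPolynomial (Fin 4) K) = X a * X b * X c :=
    homogeneousComponent_eq_self (((isHomogeneous_X K a).mul (isHomogeneous_X K b)).mul (isHomogeneous_X K c))
  have hcomp : C (constantCoeff u) * (C a₀ * (∑ i, C (ℓ i) * X i) ^ d) =
      homogeneousComponent (d - 3) S * (X a * X b * X c) +
        C (constantCoeff T) * (C κ * ∑ i, C (ℓ i) * X i) ^ d := by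
    have h1 := congrArg (homogeneousComponent d) hG
    have huG := homogeneousComponent_mul_of_le_ordZero h0u hoG
    have hSX := homogeneousComponent_mul_of_le_ordZero hoS h3X
    have hTh := homogeneousComponent_mul_of_le_ordZero h0T hohd
    have hpow := homogeneousComponent_pow_of_le_ordZero hoh d
    rw [zero_add] at huG hTh
    rw [mul_one] at hpow
    rw [show d - 3 + 3 = d by omega] at hSX
    rw [map_add, huG, hSX, hTh, hpow, hcone, hlin, hXabc, homogeneousComponent_zero, homogeneousComponent_zero] at h1
    simpa only [← constantCoeff_eq] using h1
  -- read the coefficient of `x_e^d`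
  have hkey : homogeneousComponent (d - 3) S * (X a * X b * X c) =
      C (constantCoeff u * a₀ - constantCoeff T * κ ^ d) * (∑ i, C (ℓ i) * X i) ^ d := by
    rw [eq_sub_of_add_eq hcomp.symm, map_sub, map_mul, map_mul, map_pow]
    ring
  have hLd : coeff (Finsupp.single e d) ((∑ i, C (ℓ i) * X i : MvPolynomial (Fin 4) K) ^ d) = ℓ e ^ d := by
    have h1 := IsolatedBand.coeff_hasseDeriv_single' e d ((∑ i, C (ℓ i) * X i : MvPolynomial (Fin 4) K) ^ d) 0
    rw [Finsupp.coe_zero, Pi.zero_apply, zero_add, Nat.choose_self, Nat.cast_one, one_mul, zero_add,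
      IsolatedBand.hasseDeriv_single_linearForm_pow, Nat.choose_self, Nat.cast_one, one_mul, Nat.sub_self,
      pow_zero, mul_one, coeff_C, if_pos rfl] at h1
    exact h1.symm
  have hcoef : constantCoeff u * a₀ - constantCoeff T * κ ^ d = 0 := by
    have h1 := congrArg (coeff (Finsupp.single e d)) hkey
    rw [coeff_C_mul, hLd, ← mul_assoc, coeff_mul_X', if_neg] at h1
    · exact (mul_eq_zero.mp h1.symm).resolve_right (pow_ne_zero _ he)
    · rw [Finsupp.mem_support_iff, Finsupp.single_eq_of_ne (Ne.symm hec)]; exact fun h => h rfl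
  have hS3 : homogeneousComponent (d - 3) S = 0 := by
    rw [hcoef, C_0, zero_mul, mul_eq_zero] at hkey
    exact hkey.resolve_right (mul_ne_zero (mul_ne_zero (X_ne_zero a) (X_ne_zero b)) (X_ne_zero c))
  refine ⟨fun m hm => ?_, ?_⟩
  · have h1 : d - 3 ≤ m.degree := by
      by_contra hlt
      exact (MvPolynomial.mem_support_iff.mp hm)
        (coeff_eq_zero_of_degree_lt_ordZero (lt_of_lt_of_le (by exact_mod_cast (show m.degree < d - 3 by omega)) hoS))
    by_contra hlt
    have hdeg : m.degree = d - 3 := by omega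
    have h2 := congrArg (coeff m) hS3
    rw [coeff_homogeneousComponent, if_pos hdeg, coeff_zero] at h2
    exact (MvPolynomial.mem_support_iff.mp hm) h2
  · rw [MvPolynomial.eval_zero]
    exact (sub_eq_zero.mp hcoef).symm

/-- **THE TRIPLE-MERGED LEVEL-2 SEED** (memo (K23 (i))): same hypotheses ⇒ `S(0) = 0` (the cofactor vanishes at
the origin, since `ord S ≥ d − 2 ≥ 1`) and `T(0)·κ^d = u(0)·a₀`. [OURS] [folklore] -/
theorem levelTwo_seed_triple {a b c : Fin 4} {G h u S T : MvPolynomial (Fin 4) K} {d : ℕ} (hd : 3 ≤ d)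
    (hG : u * G = S * (X a * X b * X c) + T * h ^ d) (hh : h ∈ originIdeal K)
    (hordG : ∀ m ∈ G.support, d ≤ m.degree) {a₀ κ : K} {ℓ : Fin 4 → K}
    (hcone : homogeneousComponent d G = C a₀ * (∑ i, C (ℓ i) * X i) ^ d)
    (hlin : homogeneousComponent 1 h = C κ * (∑ i, C (ℓ i) * X i)) {e : Fin 4} (hec : e ≠ c)
    (he : ℓ e ≠ 0) :
    MvPolynomial.eval 0 S = 0 ∧ MvPolynomial.eval 0 T * κ ^ d = MvPolynomial.eval 0 u * a₀ := by
  obtain ⟨hS, hT⟩ := levelTwo_seed_triple_order hd hG hh hordG hcone hlin hec he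
  refine ⟨?_, hT⟩
  rw [MvPolynomial.eval_zero, constantCoeff_eq]
  by_contra hne
  have h := hS 0 (MvPolynomial.mem_support_iff.mpr hne)
  rw [map_zero] at h
  omega

end ResCone

namespace IsolatedBand

/-! ## 2. The triple-product isolation witness -/

/-- `u·G = S·(x_a x_b x_c) + T·h^d`, `S ∈ (x_a, x_b, h)`, `d ≥ 3` ⇒ `u·G ∈ (x_a, x_b, h)³`. [folklore] -/
theorem unit_mul_mem_span_triple_pow_three' {d : ℕ} {a b c : Fin 4} {G h u S T : MvPolynomial (Fin 4) K}
    (hG : u * G = S * (X a * X b * X c) + T * h ^ d) (hd : 3 ≤ d)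
    (hS : S ∈ Ideal.span {(X a : MvPolynomial (Fin 4) K), X b, h}) :
    u * G ∈ (Ideal.span {(X a : MvPolynomial (Fin 4) K), X b, h}) ^ 3 := by
  set I : Ideal (MvPolynomial (Fin 4) K) := Ideal.span {(X a : MvPolynomial (Fin 4) K), X b, h} with hI
  have hXa : (X a : MvPolynomial (Fin 4) K) ∈ I := Ideal.subset_span (by simp)
  have hXb : (X b : MvPolynomial (Fin 4) K) ∈ I := Ideal.subset_span (by simp)
  have hh : h ∈ I := Ideal.subset_span (by simp)
  rw [hG]
  refine add_mem ?_ ?_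
  · rw [← mul_assoc, show (3 : ℕ) = 1 + (1 + 1) by rfl, pow_add, pow_add, pow_one]
    exact Ideal.mul_mem_right _ _ (Ideal.mul_mem_mul hS (Ideal.mul_mem_mul hXa hXb))
  · exact Ideal.mul_mem_left _ _ (Ideal.pow_le_pow_right hd (Ideal.pow_mem_pow hh d))

/-- **LEVEL-2 ISOLATION WITNESS, triple form** (memo (K23 (iii))): if `u(0) ≠ 0`, `h ∈ 𝔪₀`, `a ≠ b`,
`u·G = S·(x_a x_b x_c) + T·h^d` with `d ≥ 3` and `S ∈ (x_a, x_b, h)`, then `x^r · G` is NOT an isolated `q`-fold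
point for `q ≤ r_a + r_b + 3`. [folklore] -/
theorem not_isIsolated_of_cofactor_mem_span_triple' {q d : ℕ} {a b c : Fin 4} (hab : a ≠ b)
    {G h u S T : MvPolynomial (Fin 4) K} (hh : h ∈ originIdeal K) (hu : MvPolynomial.eval (0 : Fin 4 → K) u ≠ 0)
    (hG : u * G = S * (X a * X b * X c) + T * h ^ d) (hd : 3 ≤ d)
    (hS : S ∈ Ideal.span {(X a : MvPolynomial (Fin 4) K), X b, h}) (r : Fin 4 →₀ ℕ)
    (hq : q ≤ r a + r b + 3) : ¬ IsIsolated q (monomial r 1 * G) := by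
  refine not_isIsolated_of_unit_mul_mem_span_triple_pow hu (IsolatedScope.X_mem_originIdeal a)
    (IsolatedScope.X_mem_originIdeal b) hh (Ideal.pow_le_pow_right hq ?_)
  rw [mul_left_comm, pow_add]
  exact Ideal.mul_mem_mul (monomial_mem_span_pow hab h r) (unit_mul_mem_span_triple_pow_three' hG hd hS)

/-- **Contrapositive**: at an isolated state `x^r · G` (`q ≤ r_a + r_b + 3`) with such a triple ledger the
level-2 cofactor does NOT vanish on the axis `{x_a = x_b = h = 0}`. [folklore] -/
theorem cofactor_not_mem_span_triple_of_isIsolated' {q d : ℕ} {a b c : Fin 4} (hab : a ≠ b)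
    {G h u S T : MvPolynomial (Fin 4) K} (hh : h ∈ originIdeal K) (hu : MvPolynomial.eval (0 : Fin 4 → K) u ≠ 0)
    (hG : u * G = S * (X a * X b * X c) + T * h ^ d) (hd : 3 ≤ d) (r : Fin 4 →₀ ℕ) (hq : q ≤ r a + r b + 3)
    (hiso : IsIsolated q (monomial r 1 * G)) :
    S ∉ Ideal.span {(X a : MvPolynomial (Fin 4) K), X b, h} :=
  fun hS => not_isIsolated_of_cofactor_mem_span_triple' hab hh hu hG hd hS r hq hiso

end IsolatedBand

end Summit.ResolutionOfSingularities.ResolutionOfSingularities.Theorems.PIDim4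

end
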